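import Summits.QuantumFields.YangMills.Theorems.EquipartitionCriticalityEquipartitionPinsProbeTangentSteinDefect
import HarnessLib

/-!
# Finite-`β` Stein identity, part 4: STUB TS7 modulo TS3/TS4 (crux `stmt-QuantumFields-8760`, line `Sketch`)

`steinFiniteBeta_of`: uniform equipartition, the statement of STUB TS3 (`stub_shiftDerivField`, with TS0
discharged) and the statement of STUB TS4 (`stub_shiftDerivAction`) imply the conclusion of STUB TS7
`stub_steinFiniteBeta`: for `S ⊇ plaquettesTouching {e}` and every `h`, the two trigonometric
single-edge Stein defects of the rescaled plaquette field under any `μ ∈ infiniteVolumeLimitPoints r.ρ β`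
are `≤ η` for all large `β` — `defect_le` (part 3) with `θ = η/(∑|h| + 1)`; the comb Poincaré inequality
(`stub_combPoincare`) and the uniform plaquette energy bound (`stub_plaquetteEnergy`) make the error
integrals `O(1/β) + O(1/√β)`. Reference: S. Chatterjee, arXiv:1602.01222 §§9–11. [arXiv160201222]
-/

noncomputable section

open MeasureTheory Filter Topology
open scoped Matrix Matrix.Norms.Frobenius
open Literature.Probability.LatticeModels Literature.MathematicalPhysics.QuantumLattice
open Literature.MathematicalPhysics.QuantumFieldTheory hiding ZdEdge IsLocalObservable IsInfiniteVolumeLimit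

namespace Summit.QuantumFields.YangMills.Theorems.EquipartitionPinsProbe

namespace TangentSteinFiniteBeta

/-! ### STUB TS7 from the statements of STUBS TS3 and TS4 -/

section Main

/-- **STUB TS7 modulo the derivative stubs.** Uniform equipartition, the statement of STUB TS3
(`stub_shiftDerivField`, with STUB TS0 already discharged) and the statement of STUB TS4
(`stub_shiftDerivAction`) imply the finite-`β` single-edge Stein identities with defects `≤ η` for all
large `β`, uniformly over torus-limit states: `defect_le` with `θ = η/(∑|h| + 1)`, the comb Poincaré
inequality (`stub_combPoincare`) and the uniform plaquette energy bound (`stub_plaquetteEnergy`) make the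
two error integrals `O(1/β) + O(1/√β)`. -/
theorem steinFiniteBeta_of :
    ∀ (G : Type) [Group G] [TopologicalSpace G] [IsTopologicalGroup G] [CompactSpace G],
      Literature.MathematicalPhysics.QuantumFieldTheory.IsCompactSimpleLieGroup G →
      letI : MeasurableSpace G := borel G
      haveI : BorelSpace G := ⟨rfl⟩
      ∀ r : Literature.MathematicalPhysics.QuantumFieldTheory.LatticeRep G,
        (∀ ε : ℝ, 0 < ε → ∀ᶠ β : ℝ in Filter.atTop,
          ∀ μ ∈ Literature.MathematicalPhysics.QuantumLattice.infiniteVolumeLimitPoints (d := 4) r.ρ β,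
            |β * (∫ U, (∑ i : Fin 4, ∑ j : Fin 4,
                if i < j then ((r.N : ℝ) - Literature.MathematicalPhysics.QuantumLattice.plaquetteObs r.ρ 0 i j U) else 0) ∂μ) -
              3 * (Summit.QuantumFields.YangMills.Theorems.EquipartitionPinsProbe.lieDim r : ℝ) / 2| < ε) →
        (∀ (b : Fin (Summit.QuantumFields.YangMills.Theorems.EquipartitionPinsProbe.lieDim r)) (k : ℝ → G),
          (∀ t : ℝ, r.ρ (k t) = NormedSpace.exp ((t : ℂ) • Summit.QuantumFields.YangMills.Theorems.EquipartitionPinsProbe.lieVec r b)) →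
          ∃ K : ℝ, ∀ (β : ℝ) (U : Literature.MathematicalPhysics.QuantumLattice.LGConfig 4 G) (e : Literature.MathematicalPhysics.QuantumLattice.ZdEdge 4) (p : Literature.MathematicalPhysics.QuantumLattice.ZdPlaquette 4) (a : Fin (Summit.QuantumFields.YangMills.Theorems.EquipartitionPinsProbe.lieDim r)), (((¬ ∀ j : Fin 4, e.2 < j → e.1 j = 0) ∨ 0 ≤ e.1 e.2) → ∃ err : ℝ, HasDerivAt (fun t : ℝ => Summit.QuantumFields.YangMills.Theorems.EquipartitionPinsProbe.plaqField r β (Function.update U e ((Summit.QuantumFields.YangMills.Theorems.EquipartitionPinsProbe.combTransport U e.1)⁻¹ * k t * Summit.QuantumFields.YangMills.Theorems.EquipartitionPinsProbe.combTransport U e.1 * U e)) p a) (Real.sqrt β * ((if a = b then Literature.MathematicalPhysics.QuantumFieldTheory.plaquetteCurl (fun e' => if e' = e then (1 : ℝ) else 0) p else 0) + err)) 0 ∧ err ^ 2 ≤ K * ∑ i : Fin 4, ((r.N : ℝ) - (r.ρ (Summit.QuantumFields.YangMills.Theorems.EquipartitionPinsProbe.axialFix U (Literature.MathematicalPhysics.QuantumFieldTheory.plaquetteBoundary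 p i))).trace.re)) ∧ ((∀ j : Fin 4, e.2 < j → e.1 j = 0) → e.1 e.2 < 0 → ∃ err : ℝ, HasDerivAt (fun t : ℝ => Summit.QuantumFields.YangMills.Theorems.EquipartitionPinsProbe.plaqField r β (Function.update U e (U e * ((Summit.QuantumFields.YangMills.Theorems.EquipartitionPinsProbe.combTransport U (e.1 + Pi.single e.2 1))⁻¹ * (k t)⁻¹ * Summit.QuantumFields.YangMills.Theorems.EquipartitionPinsProbe.combTransport U (e.1 + Pi.single e.2 1)))) p a) (Real.sqrt β * (-(if a = b then Literature.MathematicalPhysics.QuantumFieldTheory.plaquetteCurl (fun e' => if e' = e then (1 : ℝ) else 0) p else 0) + err)) 0 ∧ err ^ 2 ≤ K * ∑ i : Fin 4, ((r.N : ℝ) - (r.ρ (Summit.QuantumFields.YangMills.Theorems.EquipartitionPinsProbe.axialFix U (Literature.MathematicalPhysics.QuantumFieldTheory.plaquetteBoundary p i))).trace.re))) →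
        (∀ (b : Fin (Summit.QuantumFields.YangMills.Theorems.EquipartitionPinsProbe.lieDim r)) (k : ℝ → G),
          (∀ t : ℝ, r.ρ (k t) = NormedSpace.exp ((t : ℂ) • Summit.QuantumFields.YangMills.Theorems.EquipartitionPinsProbe.lieVec r b)) →
          ∃ K : ℝ, ∀ (β : ℝ) (U : Literature.MathematicalPhysics.QuantumLattice.LGConfig 4 G) (e : Literature.MathematicalPhysics.QuantumLattice.ZdEdge 4), (((¬ ∀ j : Fin 4, e.2 < j → e.1 j = 0) ∨ 0 ≤ e.1 e.2) → ∃ D : ℝ, HasDerivAt (fun t : ℝ => Literature.MathematicalPhysics.QuantumLattice.wilsonBoundaryAction r.ρ {e} (Function.update U e ((Summit.QuantumFields.YangMills.Theorems.EquipartitionPinsProbe.combTransport U e.1)⁻¹ * k t * Summit.QuantumFields.YangMills.Theorems.EquipartitionPinsProbe.combTransport U e.1 * U e))) D 0 ∧ |Real.sqrt β * D - ∑ q ∈ Literature.MathematicalPhysics.QuantumLattice.plaquettesTouching {e}, Literature.MathematicalPhysics.QuantumFieldTheory.plaquetteCurl (fun e' => if e' = e then (1 : ℝ) else 0) q * Summit.QuantumFields.YangMills.Theorems.EquipartitionPinsProbe.plaqField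 r β U q b| ≤ K * Real.sqrt β * ∑ q ∈ Literature.MathematicalPhysics.QuantumLattice.plaquettesTouching {e}, ∑ i : Fin 4, ((r.N : ℝ) - (r.ρ (Summit.QuantumFields.YangMills.Theorems.EquipartitionPinsProbe.axialFix U (Literature.MathematicalPhysics.QuantumFieldTheory.plaquetteBoundary q i))).trace.re)) ∧ ((∀ j : Fin 4, e.2 < j → e.1 j = 0) → e.1 e.2 < 0 → ∃ D : ℝ, HasDerivAt (fun t : ℝ => Literature.MathematicalPhysics.QuantumLattice.wilsonBoundaryAction r.ρ {e} (Function.update U e (U e * ((Summit.QuantumFields.YangMills.Theorems.EquipartitionPinsProbe.combTransport U (e.1 + Pi.single e.2 1))⁻¹ * (k t)⁻¹ * Summit.QuantumFields.YangMills.Theorems.EquipartitionPinsProbe.combTransport U (e.1 + Pi.single e.2 1))))) D 0 ∧ |Real.sqrt β * D + ∑ q ∈ Literature.MathematicalPhysics.QuantumLattice.plaquettesTouching {e}, Literature.MathematicalPhysics.QuantumFieldTheory.plaquetteCurl (fun e' => if e' = e then (1 : ℝ) else 0) q * Summit.QuantumFields.YangMills.Theorems.EquipartitionPinsProbe.plaqField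 r β U q b| ≤ K * Real.sqrt β * ∑ q ∈ Literature.MathematicalPhysics.QuantumLattice.plaquettesTouching {e}, ∑ i : Fin 4, ((r.N : ℝ) - (r.ρ (Summit.QuantumFields.YangMills.Theorems.EquipartitionPinsProbe.axialFix U (Literature.MathematicalPhysics.QuantumFieldTheory.plaquetteBoundary q i))).trace.re))) →
        ∀ (e : Literature.MathematicalPhysics.QuantumLattice.ZdEdge 4) (b : Fin (Summit.QuantumFields.YangMills.Theorems.EquipartitionPinsProbe.lieDim r))
          (S : Finset (Literature.MathematicalPhysics.QuantumLattice.ZdPlaquette 4))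
          (h : Literature.MathematicalPhysics.QuantumLattice.ZdPlaquette 4 → Fin (Summit.QuantumFields.YangMills.Theorems.EquipartitionPinsProbe.lieDim r) → ℝ),
          Literature.MathematicalPhysics.QuantumLattice.plaquettesTouching {e} ⊆ S →
          ∀ η : ℝ, 0 < η → ∀ᶠ β : ℝ in Filter.atTop,
            ∀ μ ∈ Literature.MathematicalPhysics.QuantumLattice.infiniteVolumeLimitPoints (d := 4) r.ρ β,
              |(∑ p ∈ S, Literature.MathematicalPhysics.QuantumFieldTheory.plaquetteCurl (fun e' => if e' = e then (1 : ℝ) else 0) p * h p b) *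
                    (∫ U, Real.sin (∑ p ∈ S, ∑ a : Fin (Summit.QuantumFields.YangMills.Theorems.EquipartitionPinsProbe.lieDim r),
                      h p a * Summit.QuantumFields.YangMills.Theorems.EquipartitionPinsProbe.plaqField r β U p a) ∂μ) +
                  ∫ U, Real.cos (∑ p ∈ S, ∑ a : Fin (Summit.QuantumFields.YangMills.Theorems.EquipartitionPinsProbe.lieDim r),
                      h p a * Summit.QuantumFields.YangMills.Theorems.EquipartitionPinsProbe.plaqField r β U p a) *
                    (∑ p ∈ S, Literature.MathematicalPhysics.QuantumFieldTheory.plaquetteCurl (fun e' => if e' = e then (1 : ℝ) else 0) p *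
                      Summit.QuantumFields.YangMills.Theorems.EquipartitionPinsProbe.plaqField r β U p b) ∂μ| ≤ η ∧
              |(∫ U, Real.sin (∑ p ∈ S, ∑ a : Fin (Summit.QuantumFields.YangMills.Theorems.EquipartitionPinsProbe.lieDim r),
                      h p a * Summit.QuantumFields.YangMills.Theorems.EquipartitionPinsProbe.plaqField r β U p a) *
                    (∑ p ∈ S, Literature.MathematicalPhysics.QuantumFieldTheory.plaquetteCurl (fun e' => if e' = e then (1 : ℝ) else 0) p *
                      Summit.QuantumFields.YangMills.Theorems.EquipartitionPinsProbe.plaqField r β U p b) ∂μ) -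
                  (∑ p ∈ S, Literature.MathematicalPhysics.QuantumFieldTheory.plaquetteCurl (fun e' => if e' = e then (1 : ℝ) else 0) p * h p b) *
                    ∫ U, Real.cos (∑ p ∈ S, ∑ a : Fin (Summit.QuantumFields.YangMills.Theorems.EquipartitionPinsProbe.lieDim r),
                      h p a * Summit.QuantumFields.YangMills.Theorems.EquipartitionPinsProbe.plaqField r β U p a) ∂μ| ≤ η := by
  intro G _ _ _ _ hG
  letI : MeasurableSpace G := borel G
  haveI : BorelSpace G := ⟨rfl⟩
  intro r hequi h3all h4all e b S h hS η hη
  haveI : SecondCountableTopology G :=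
    (r.continuous.isClosedEmbedding r.injective).isEmbedding.secondCountableTopology
  haveI : T2Space G := (r.continuous.isClosedEmbedding r.injective).isEmbedding.t2Space
  -- the one-parameter subgroup and the derivative constants
  obtain ⟨k, hk⟩ := exists_oneParam r b
  obtain ⟨K₃, h3⟩ := h3all b k hk
  obtain ⟨K₄, h4⟩ := h4all b k hk
  set K : ℝ := max (max K₃ K₄) 0 with hKdef
  have hK0 : 0 ≤ K := le_max_right _ _
  have hK3 : K₃ ≤ K := (le_max_left _ _).trans (le_max_left _ _)
  have hK4 : K₄ ≤ K := (le_max_right _ _).trans (le_max_left _ _)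
  -- comb-Poincaré data and the uniform plaquette energy bound
  choose Sq Cq hCq hSC using stub_combPoincare G r.ρ r.mem_unitary
  have hTE := stub_plaquetteEnergy G hG r hequi
  set E₀ : ℝ := 3 * (lieDim r : ℝ) / 2 + 1 with hE₀
  -- constants
  set Pe := plaquettesTouching ({e} : Finset (Literature.MathematicalPhysics.QuantumLattice.ZdEdge 4)) with hPe
  set Hs : ℝ := ∑ p ∈ S, ∑ a : Fin (lieDim r), |h p a| with hHs
  have hHs0 : 0 ≤ Hs := Finset.sum_nonneg fun p _ => Finset.sum_nonneg fun a _ => abs_nonneg _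
  set θ : ℝ := η / (Hs + 1) with hθ
  have hθpos : 0 < θ := div_pos hη (by linarith)
  set A : ZdPlaquette 4 → ℝ := fun p => ∑ i : Fin 4, Cq (plaquetteBoundary p i) *
    ∑ _q ∈ Sq (plaquetteBoundary p i), E₀ with hA
  set C₁ : ℝ := K / (2 * θ) * ∑ p ∈ S, ∑ a : Fin (lieDim r), |h p a| * A p with hC₁
  set C₂ : ℝ := K * ∑ q ∈ Pe, A q with hC₂
  have hR : Tendsto (fun β : ℝ => C₁ / β + C₂ / Real.sqrt β) atTop (𝓝 0) := by
    have h1 : Tendsto (fun β : ℝ => C₁ / β) atTop (𝓝 0) := tendsto_const_nhds.div_atTop tendsto_id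
    have h2 : Tendsto (fun β : ℝ => C₂ / Real.sqrt β) atTop (𝓝 0) :=
      tendsto_const_nhds.div_atTop Real.tendsto_sqrt_atTop
    simpa using h1.add h2
  filter_upwards [hTE, eventually_gt_atTop (0 : ℝ), hR.eventually (Iic_mem_nhds (half_pos hη))] with β hP hβ hRβ
  intro μ hμ
  haveI : IsProbabilityMeasure μ := by
    obtain ⟨L, -, hPr, -⟩ := hμ
    exact hPr
  have hsβ : 0 < Real.sqrt β := Real.sqrt_pos.2 hβ
  obtain ⟨hd1, hd2⟩ := defect_le r b hk hK0 hK3 hK4 h3 h4 hβ μ hμ e S hS h hθpos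
  -- the bound `∫ W_p dμ ≤ A_p / β`
  have hEq : ∀ q : ZdPlaquette 4, ∫ U, ((r.N : ℝ) - plaquetteObs r.ρ q.1 q.2.1.1 q.2.1.2 U) ∂μ ≤ E₀ / β := fun q => by
    rw [le_div_iff₀ hβ, mul_comm]
    exact ((hP μ hμ) q).2
  have hWint : ∀ p : ZdPlaquette 4, Integrable (fun U : LGConfig 4 G =>
      ∑ i : Fin 4, ((r.N : ℝ) - (r.ρ (axialFix U (plaquetteBoundary p i))).trace.re)) μ := fun p => by
    have hc : Continuous fun U : LGConfig 4 G =>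
        ∑ i : Fin 4, ((r.N : ℝ) - (r.ρ (axialFix U (plaquetteBoundary p i))).trace.re) :=
      continuous_finsetSum _ fun i _ => continuous_const.sub
        (Complex.continuous_re.comp ((r.continuous.comp (TangentPlaqFieldContinuous.continuous_axialFix _)).matrix_trace))
    obtain ⟨C, -, hC⟩ := exists_abs_le_of_continuous hc
    exact Integrable.of_bound hc.measurable.aestronglyMeasurable C (ae_of_all _ fun U => by rw [Real.norm_eq_abs]; exact hC U)
  have hWle : ∀ p : ZdPlaquette 4, ∫ U, ∑ i : Fin 4, ((r.N : ℝ) - (r.ρ (axialFix U (plaquetteBoundary p i))).trace.re) ∂μ ≤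
      A p / β := fun p => by
    have hpt : ∀ U : LGConfig 4 G, ∑ i : Fin 4, ((r.N : ℝ) - (r.ρ (axialFix U (plaquetteBoundary p i))).trace.re) ≤
        ∑ i : Fin 4, Cq (plaquetteBoundary p i) * ∑ q ∈ Sq (plaquetteBoundary p i),
          ((r.N : ℝ) - plaquetteObs r.ρ q.1 q.2.1.1 q.2.1.2 U) := fun U =>
      Finset.sum_le_sum fun i _ => hSC _ U
    have hint : ∀ q : ZdPlaquette 4,
        Integrable (fun U => (r.N : ℝ) - plaquetteObs r.ρ q.1 q.2.1.1 q.2.1.2 U) μ := fun q =>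
      TangentPlaquetteEnergy.integrable_sub_plaquetteObs r.ρ r.continuous r.mem_unitary μ _ _ _
    have hintR : Integrable (fun U => ∑ i : Fin 4, Cq (plaquetteBoundary p i) * ∑ q ∈ Sq (plaquetteBoundary p i),
        ((r.N : ℝ) - plaquetteObs r.ρ q.1 q.2.1.1 q.2.1.2 U)) μ :=
      integrable_finsetSum _ fun i _ => (integrable_finsetSum _ fun q _ => hint q).const_mul _
    refine (integral_mono (hWint p) hintR hpt).trans ?_
    rw [integral_finsetSum _ fun i _ => (integrable_finsetSum _ fun q _ => hint q).const_mul _, hA]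
    dsimp only
    rw [Finset.sum_div]
    refine Finset.sum_le_sum fun i _ => ?_
    rw [integral_const_mul, integral_finsetSum _ fun q _ => hint q, mul_div_assoc, Finset.sum_div]
    exact mul_le_mul_of_nonneg_left (Finset.sum_le_sum fun q _ => hEq q) (hCq _)
  -- the first term
  have hΦ : (∫ U, ∑ p ∈ S, ∑ a, |h p a| * (θ / 2 +
      K * (∑ i : Fin 4, ((r.N : ℝ) - (r.ρ (axialFix U (plaquetteBoundary p i))).trace.re)) / (2 * θ)) ∂μ) ≤
      η / 2 + C₁ / β := by
    have hlin : (∫ U, ∑ p ∈ S, ∑ a, |h p a| * (θ / 2 +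
        K * (∑ i : Fin 4, ((r.N : ℝ) - (r.ρ (axialFix U (plaquetteBoundary p i))).trace.re)) / (2 * θ)) ∂μ) =
        ∑ p ∈ S, ∑ a : Fin (lieDim r), |h p a| * (θ / 2 + K * (∫ U, ∑ i : Fin 4,
          ((r.N : ℝ) - (r.ρ (axialFix U (plaquetteBoundary p i))).trace.re) ∂μ) / (2 * θ)) := by
      have hterm : ∀ (p : ZdPlaquette 4) (a : Fin (lieDim r)), Integrable (fun U : LGConfig 4 G => |h p a| * (θ / 2 +
          K * (∑ i : Fin 4, ((r.N : ℝ) - (r.ρ (axialFix U (plaquetteBoundary p i))).trace.re)) / (2 * θ))) μ :=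
        fun p a => ((integrable_const _).add (((hWint p).const_mul K).div_const _)).const_mul _
      rw [integral_finsetSum _ fun p _ => integrable_finsetSum _ fun a _ => hterm p a]
      refine Finset.sum_congr rfl fun p _ => ?_
      rw [integral_finsetSum _ fun a _ => hterm p a]
      refine Finset.sum_congr rfl fun a _ => ?_
      rw [integral_const_mul, integral_add (integrable_const _) (((hWint p).const_mul K).div_const _), integral_const,
        integral_div, integral_const_mul]
      simp
    rw [hlin]
    have hstep : ∀ p ∈ S, ∀ a : Fin (lieDim r), |h p a| * (θ / 2 + K * (∫ U, ∑ i : Fin 4,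
        ((r.N : ℝ) - (r.ρ (axialFix U (plaquetteBoundary p i))).trace.re) ∂μ) / (2 * θ)) ≤
        |h p a| * (θ / 2) + K / (2 * θ) * (|h p a| * A p) / β := fun p _ a => by
      have h1 : K * (∫ U, ∑ i : Fin 4, ((r.N : ℝ) - (r.ρ (axialFix U (plaquetteBoundary p i))).trace.re) ∂μ) / (2 * θ) ≤
          K * (A p / β) / (2 * θ) :=
        div_le_div_of_nonneg_right (mul_le_mul_of_nonneg_left (hWle p) hK0) (by positivity)
      have h2 := mul_le_mul_of_nonneg_left (add_le_add (le_refl (θ / 2)) h1) (abs_nonneg (h p a))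
      refine h2.trans_eq ?_
      field_simp
    refine (Finset.sum_le_sum fun p hp => Finset.sum_le_sum fun a _ => hstep p hp a).trans ?_
    rw [hC₁]
    simp only [Finset.sum_add_distrib, ← Finset.sum_mul, ← Finset.mul_sum, ← Finset.sum_div]
    refine add_le_add ?_ le_rfl
    rw [hθ]
    rw [show Hs * (η / (Hs + 1) / 2) = η / 2 * (Hs / (Hs + 1)) by ring]
    refine (mul_le_of_le_one_right (half_pos hη).le ?_)
    rw [div_le_one (by linarith)]
    linarith
  -- the second term
  have hSW2 : K * Real.sqrt β * ∫ U, ∑ q ∈ Pe, ∑ i : Fin 4,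
      ((r.N : ℝ) - (r.ρ (axialFix U (plaquetteBoundary q i))).trace.re) ∂μ ≤ C₂ / Real.sqrt β := by
    rw [integral_finsetSum _ fun q _ => hWint q]
    have h1 : ∑ q ∈ Pe, ∫ U, ∑ i : Fin 4, ((r.N : ℝ) - (r.ρ (axialFix U (plaquetteBoundary q i))).trace.re) ∂μ ≤
        (∑ q ∈ Pe, A q) / β := by
      rw [Finset.sum_div]
      exact Finset.sum_le_sum fun q _ => hWle q
    refine (mul_le_mul_of_nonneg_left h1 (mul_nonneg hK0 hsβ.le)).trans_eq ?_
    rw [hC₂]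
    have hββ : β = Real.sqrt β * Real.sqrt β := (Real.mul_self_sqrt hβ.le).symm
    field_simp
    nth_rewrite 2 [hββ]
    ring
  have hsum : (∫ U, ∑ p ∈ S, ∑ a, |h p a| * (θ / 2 +
      K * (∑ i : Fin 4, ((r.N : ℝ) - (r.ρ (axialFix U (plaquetteBoundary p i))).trace.re)) / (2 * θ)) ∂μ) +
      K * Real.sqrt β * ∫ U, ∑ q ∈ Pe, ∑ i : Fin 4,
        ((r.N : ℝ) - (r.ρ (axialFix U (plaquetteBoundary q i))).trace.re) ∂μ ≤ η := by
    have : C₁ / β + C₂ / Real.sqrt β ≤ η / 2 := hRβ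
    linarith
  exact ⟨hd1.trans hsum, hd2.trans hsum⟩

end Main

end TangentSteinFiniteBeta

/-- STUB TS7 `stub_steinFiniteBeta` of line `Sketch` (crux `stmt-QuantumFields-8760`) — **the differentiated
skew Haar shift at finite `β`**: under uniform equipartition, for `S ⊇ plaquettesTouching {e}` and every `h`,
the defects of the two trigonometric single-edge Stein identities of the rescaled plaquette field `Y^β` under
any `μ ∈ infiniteVolumeLimitPoints r.ρ β` are `≤ η` for all large `β` (`steinFiniteBeta_of` with STUBS TS3
`stub_shiftDerivField` (+ TS0 `stub_combShift`) and TS4 `stub_shiftDerivAction`). -/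
theorem stub_steinFiniteBeta :
    ∀ (G : Type) [Group G] [TopologicalSpace G] [IsTopologicalGroup G] [CompactSpace G],
      Literature.MathematicalPhysics.QuantumFieldTheory.IsCompactSimpleLieGroup G →
      letI : MeasurableSpace G := borel G; haveI : BorelSpace G := ⟨rfl⟩;
      ∀ r : Literature.MathematicalPhysics.QuantumFieldTheory.LatticeRep G,
        (∀ ε : ℝ, 0 < ε → ∀ᶠ β : ℝ in Filter.atTop,
          ∀ μ ∈ Literature.MathematicalPhysics.QuantumLattice.infiniteVolumeLimitPoints (d := 4) r.ρ β,
            |β * (∫ U, (∑ i : Fin 4, ∑ j : Fin 4,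
                if i < j then ((r.N : ℝ) - Literature.MathematicalPhysics.QuantumLattice.plaquetteObs r.ρ 0 i j U) else 0) ∂μ) -
              3 * (Summit.QuantumFields.YangMills.Theorems.EquipartitionPinsProbe.lieDim r : ℝ) / 2| < ε) →
        ∀ (e : Literature.MathematicalPhysics.QuantumLattice.ZdEdge 4) (b : Fin (Summit.QuantumFields.YangMills.Theorems.EquipartitionPinsProbe.lieDim r))
          (S : Finset (Literature.MathematicalPhysics.QuantumLattice.ZdPlaquette 4))
          (h : Literature.MathematicalPhysics.QuantumLattice.ZdPlaquette 4 → Fin (Summit.QuantumFields.YangMills.Theorems.EquipartitionPinsProbe.lieDim r) → ℝ),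
          Literature.MathematicalPhysics.QuantumLattice.plaquettesTouching {e} ⊆ S →
          ∀ η : ℝ, 0 < η → ∀ᶠ β : ℝ in Filter.atTop,
            ∀ μ ∈ Literature.MathematicalPhysics.QuantumLattice.infiniteVolumeLimitPoints (d := 4) r.ρ β,
              |(∑ p ∈ S, Literature.MathematicalPhysics.QuantumFieldTheory.plaquetteCurl (fun e' => if e' = e then (1 : ℝ) else 0) p * h p b) *
                    (∫ U, Real.sin (∑ p ∈ S, ∑ a : Fin (Summit.QuantumFields.YangMills.Theorems.EquipartitionPinsProbe.lieDim r),
                      h p a * Summit.QuantumFields.YangMills.Theorems.EquipartitionPinsProbe.plaqField r β U p a) ∂μ) +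
                  ∫ U, Real.cos (∑ p ∈ S, ∑ a : Fin (Summit.QuantumFields.YangMills.Theorems.EquipartitionPinsProbe.lieDim r),
                      h p a * Summit.QuantumFields.YangMills.Theorems.EquipartitionPinsProbe.plaqField r β U p a) *
                    (∑ p ∈ S, Literature.MathematicalPhysics.QuantumFieldTheory.plaquetteCurl (fun e' => if e' = e then (1 : ℝ) else 0) p *
                      Summit.QuantumFields.YangMills.Theorems.EquipartitionPinsProbe.plaqField r β U p b) ∂μ| ≤ η ∧
              |(∫ U, Real.sin (∑ p ∈ S, ∑ a : Fin (Summit.QuantumFields.YangMills.Theorems.EquipartitionPinsProbe.lieDim r),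
                      h p a * Summit.QuantumFields.YangMills.Theorems.EquipartitionPinsProbe.plaqField r β U p a) *
                    (∑ p ∈ S, Literature.MathematicalPhysics.QuantumFieldTheory.plaquetteCurl (fun e' => if e' = e then (1 : ℝ) else 0) p *
                      Summit.QuantumFields.YangMills.Theorems.EquipartitionPinsProbe.plaqField r β U p b) ∂μ) -
                  (∑ p ∈ S, Literature.MathematicalPhysics.QuantumFieldTheory.plaquetteCurl (fun e' => if e' = e then (1 : ℝ) else 0) p * h p b) *
                    ∫ U, Real.cos (∑ p ∈ S, ∑ a : Fin (Summit.QuantumFields.YangMills.Theorems.EquipartitionPinsProbe.lieDim r),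
                      h p a * Summit.QuantumFields.YangMills.Theorems.EquipartitionPinsProbe.plaqField r β U p a) ∂μ| ≤ η := by
  intro G _ _ _ _ hG
  letI : MeasurableSpace G := borel G
  haveI : BorelSpace G := ⟨rfl⟩
  intro r hequi
  exact TangentSteinFiniteBeta.steinFiniteBeta_of G hG r hequi
    (fun b k hk => stub_shiftDerivField G r b k hk (stub_combShift G)) (fun b k hk => stub_shiftDerivAction G r b k hk)

end Summit.QuantumFields.YangMills.Theorems.EquipartitionPinsProbe

end
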